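import Mathlib.GroupTheory.GroupAction.Basic
import Literature.MathematicalPhysics.QuantumLattice.SpinChargeKinematics
import HarnessLib

/-!
# Invariant vectors are spanned by orbit indicators (the symmetry-adapted "orbit basis" of
# symmetry-reduced exact diagonalisation)

Topic `MathematicalPhysics/QuantumLattice` (family `hubbard`); companion of
`GroundStateEnclosureCertificate.lean` (frame certificates `TempleKato.exists_codimOne_of_frame_certificate`,
whose hypothesis `∀ x ∈ K, ∃ y, Φ *ᵥ y = x` asks that the columns of the frame `Φ` SPAN the
sector `K`) and `HeisenbergGroundStateSymmetry.lean` (the ground state lies in the subspace `K` of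
`Sᶻ = 0` vectors fixed by the lattice symmetries). Symmetry-reduced exact diagonalisation in the
trivial representation works in the "orbit basis": one vector `b_O = Σ_{σ ∈ O} |σ⟩` per orbit `O`
of the symmetry group on basis configurations. This file proves the (folklore) completeness of
that basis: a vector invariant under a finite group action on the index set is a linear
combination of orbit indicators — indeed `v = Σ_x (v x / |orbit x|) · 𝟙_{orbit x}`, no choice of
representatives needed — and only orbits through the support of `v` occur. With generators:
invariance under a generating set of permutations suffices (`Subgroup.closure`).

* `TempleKato.mem_span_orbitIndicator` — `v (g • x) = v x` for all `g` ⇒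
  `v ∈ span {𝟙_{orbit x₀} | v x₀ ≠ 0}`.
* `TempleKato.mem_span_orbitIndicator_of_generators` — the same for the subgroup of `Equiv.Perm X`
  generated by a set `S` of permutations each fixing `v`.
* `TempleKato.permOp_mulVec_eq_self_iff` — dictionary with the permutation unitaries of site
  relabellings: `permOp e v = v ↔ ∀ σ, v (configPerm e σ) = v σ`.

General linear algebra of permutation representations (e.g. Serre, *Linear Representations of
Finite Groups*, §1.2: the permutation representation and its invariants); no definitions, no
named facts. [folklore]
-/

noncomputable section

open Finset Matrix
open scoped BigOperators

namespace Literature.MathematicalPhysics.QuantumLattice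

namespace TempleKato

section Orbit

variable {X : Type*} [Fintype X] [DecidableEq X] {Gp : Type*} [Group Gp] [MulAction Gp X]

omit [Fintype X] [DecidableEq X] in
/-- Orbit membership is symmetric. [folklore] -/
theorem mem_orbit_comm {x y : X} (h : y ∈ MulAction.orbit Gp x) : x ∈ MulAction.orbit Gp y := by
  obtain ⟨g, rfl⟩ := MulAction.mem_orbit_iff.1 h
  exact MulAction.mem_orbit_iff.2 ⟨g⁻¹, inv_smul_smul g x⟩

omit [Fintype X] [DecidableEq X] in
/-- An invariant function is constant on orbits. [folklore] -/
theorem apply_eq_of_mem_orbit {v : X → ℂ} (hv : ∀ (g : Gp) (x : X), v (g • x) = v x) {x y : X}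
    (h : y ∈ MulAction.orbit Gp x) : v y = v x := by
  obtain ⟨g, rfl⟩ := MulAction.mem_orbit_iff.1 h
  exact hv g x

omit [DecidableEq X] in
open scoped Classical in
/-- **The orbit-indicator expansion of an invariant vector**:
`v = Σ_x (v x / |orbit x|) · 𝟙_{orbit x}` for `v` invariant under a group action on a finite index
set (each `y` receives `Σ_{x ∈ orbit y} v y / |orbit y| = v y`). [folklore] -/
theorem eq_sum_smul_orbitIndicator (v : X → ℂ) (hv : ∀ (g : Gp) (x : X), v (g • x) = v x) :
    v = ∑ x, (v x / ((univ.filter fun y => y ∈ MulAction.orbit Gp x).card : ℂ)) •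
      (MulAction.orbit Gp x).indicator (fun _ => (1 : ℂ)) := by
  classical
  funext y
  simp only [Finset.sum_apply, Pi.smul_apply, smul_eq_mul, Set.indicator_apply, mul_ite, mul_one,
    mul_zero]
  rw [← Finset.sum_filter]
  -- the `x` with `y ∈ orbit x` are exactly the points of `orbit y`
  have hfilter : (univ.filter fun x => y ∈ MulAction.orbit Gp x) =
      univ.filter fun x => x ∈ MulAction.orbit Gp y := by
    ext x
    simp only [Finset.mem_filter, Finset.mem_univ, true_and]
    exact ⟨mem_orbit_comm, mem_orbit_comm⟩
  rw [hfilter]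
  -- on `orbit y` every summand equals `v y / |orbit y|`
  have hconst : ∀ x ∈ univ.filter (fun x => x ∈ MulAction.orbit Gp y),
      v x / ((univ.filter fun z => z ∈ MulAction.orbit Gp x).card : ℂ) =
        v y / ((univ.filter fun z => z ∈ MulAction.orbit Gp y).card : ℂ) := by
    intro x hx
    have hx' : x ∈ MulAction.orbit Gp y := (Finset.mem_filter.1 hx).2
    have horb : MulAction.orbit Gp x = MulAction.orbit Gp y := MulAction.orbit_eq_iff.2 hx'
    rw [apply_eq_of_mem_orbit hv hx', horb]
  rw [Finset.sum_congr rfl hconst, Finset.sum_const, nsmul_eq_mul]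
  have hpos : 0 < (univ.filter fun z => z ∈ MulAction.orbit Gp y).card :=
    Finset.card_pos.2 ⟨y, Finset.mem_filter.2 ⟨Finset.mem_univ _, MulAction.mem_orbit_self y⟩⟩
  have hne : ((univ.filter fun z => z ∈ MulAction.orbit Gp y).card : ℂ) ≠ 0 := by
    exact_mod_cast hpos.ne'
  rw [mul_div_cancel₀ _ hne]

omit [DecidableEq X] in
/-- **Invariant vectors are spanned by the orbit indicators through their support.** For `v`
invariant under a group acting on a finite index set, `v ∈ span {𝟙_{orbit x₀} | v x₀ ≠ 0}`; in
particular a vector of a symmetry sector fixed by the symmetry group lies in the span of the orbit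
basis of that sector (completeness of the orbit basis of symmetry-reduced exact diagonalisation).
[folklore] -/
theorem mem_span_orbitIndicator (v : X → ℂ) (hv : ∀ (g : Gp) (x : X), v (g • x) = v x) :
    v ∈ Submodule.span ℂ
      ((fun x₀ : X => (MulAction.orbit Gp x₀).indicator (fun _ => (1 : ℂ))) '' {x₀ | v x₀ ≠ 0}) := by
  classical
  have key := eq_sum_smul_orbitIndicator v hv
  have hmem : (∑ x, (v x / ((univ.filter fun y => y ∈ MulAction.orbit Gp x).card : ℂ)) •
      (MulAction.orbit Gp x).indicator (fun _ => (1 : ℂ))) ∈ Submodule.span ℂ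
      ((fun x₀ : X => (MulAction.orbit Gp x₀).indicator (fun _ => (1 : ℂ))) '' {x₀ | v x₀ ≠ 0}) := by
    apply Submodule.sum_mem
    intro x _
    by_cases hx : v x = 0
    · simp only [hx, zero_div, zero_smul]
      exact Submodule.zero_mem _
    · exact Submodule.smul_mem _ _ (Submodule.subset_span ⟨x, hx, rfl⟩)
  rw [← key] at hmem
  exact hmem

end Orbit

section Generators

variable {X : Type*} [Fintype X] [DecidableEq X]

omit [Fintype X] [DecidableEq X] in
/-- Invariance under a generating set of permutations extends to the generated subgroup.
[folklore] -/
theorem apply_perm_eq_of_generators (S : Set (Equiv.Perm X)) (v : X → ℂ)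
    (hv : ∀ g ∈ S, ∀ x, v (g x) = v x) {g : Equiv.Perm X} (hg : g ∈ Subgroup.closure S) (x : X) :
    v (g x) = v x := by
  induction hg using Subgroup.closure_induction generalizing x with
  | mem g hg => exact hv g hg x
  | one => rfl
  | mul g h _ _ ihg ihh => rw [Equiv.Perm.mul_apply, ihg, ihh]
  | inv g _ ih =>
    have h := ih (g⁻¹ x)
    rw [Equiv.Perm.inv_def, Equiv.apply_symm_apply] at h
    exact h.symm

omit [DecidableEq X] in
/-- **Generator version.** If every permutation of a set `S` fixes `v` (`v ∘ g = v`), then `v` lies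
in the span of the indicators of the orbits, through the support of `v`, of the subgroup of
`Equiv.Perm X` generated by `S` (acting by evaluation). [folklore] -/
theorem mem_span_orbitIndicator_of_generators (S : Set (Equiv.Perm X)) (v : X → ℂ)
    (hv : ∀ g ∈ S, ∀ x, v (g x) = v x) :
    v ∈ Submodule.span ℂ
      ((fun x₀ : X => (MulAction.orbit (Subgroup.closure S) x₀).indicator (fun _ => (1 : ℂ))) ''
        {x₀ | v x₀ ≠ 0}) := by
  refine mem_span_orbitIndicator v fun g x => ?_
  rw [Subgroup.smul_def, Equiv.Perm.smul_def]
  exact apply_perm_eq_of_generators S v hv g.2 x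

end Generators

section Lattice

variable {Λ : Type*} [Fintype Λ] [DecidableEq Λ] {q : ℕ}

/-- Dictionary with the permutation unitaries of site relabellings (`SpinChargeKinematics.permOp`):
`permOp e v = v` iff `v` is fixed by the configuration permutation `configPerm e`
(`σ ↦ σ ∘ e`). [folklore] -/
theorem permOp_mulVec_eq_self_iff (e : Λ ≃ Λ) (v : TensorIndex Λ q → ℂ) :
    (permOp e : Op Λ q) *ᵥ v = v ↔ ∀ σ, v (configPerm e σ) = v σ := by
  rw [permOp_mulVec]
  constructor
  · intro h σ
    have := congrFun h σ
    rw [configPerm_apply]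
    exact this
  · intro h
    funext σ
    rw [← configPerm_apply]
    exact h σ

end Lattice

end TempleKato

end Literature.MathematicalPhysics.QuantumLattice

end
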